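import Mathlib.Analysis.SpecialFunctions.Integrals.Basic
import Mathlib.MeasureTheory.Integral.IntervalIntegral.FundThmCalculus
import Mathlib.Analysis.Calculus.ContDiff.Deriv
import HarnessLib

/-!
# The adjoint mode `sin θ cos² θ` of the angular operator ([Elgindi2021] §7.1, Proposition 7.1
Step 1)

Topic `Literature/Analysis/FluidPDE`. Proof file (everything proved, no definitions, no named
facts) on the proof path of the named fact
`Literature.Analysis.FluidPDE.Elgindi.ElgindiGhoulMasmoudi2021_stabilityCore`
(`ElgindiStabilityDecomposition.lean`). T. M. Elgindi, Ann. of Math. 194 (2021) =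
arXiv:1904.04795, §7.1 proof of Proposition 7.1, Step 1 (p. 19):

> "An important observation is that under the conditions of the lemma, `Ψ` must also be orthogonal
> to `sin(θ)cos²(θ)`. Indeed, define `Ψ_⋆(R) := ∫₀^{π/2}Ψ(R,θ)sin(θ)cos²(θ)dθ`. Then, we see:
> `α²R²∂_RRΨ_⋆ + α(5+α)R∂_RΨ_⋆ = 0.` This is because `sin(θ)cos²(θ)` is in the kernel of the adjoint
> problem when `α = 0`."

The angular part of `L(Ψ) = −α²R²Ψ_RR − α(5+α)RΨ_R − Ψ_θθ + ∂_θ(tanθ Ψ) − 6Ψ` is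
`L_θu = −u'' + (tanθ·u)' − 6u`, and against the mode `φ₀ = sinθcos²θ` its singular coefficient is
harmless: `(tanθ·u)'φ₀ = u sinθ + u' sin²θcosθ`. This file proves the printed kernel statement in the
integrated form used in Step 1: for `u ∈ C²(ℝ)` with `u(0) = u(π/2) = 0`,
`∫₀^{π/2}(L_θu)φ₀ dθ = ∫₀^{π/2}(−u''sinθcos²θ + u'sin²θcosθ + u(sinθ − 6sinθcos²θ))dθ = 0`
(`integral_angularOp_mul_adjointMode`), through the explicit antiderivative
`−u'φ₀ + uφ₀' + u sin²θcosθ` (equivalently `−φ₀'' − tanθφ₀' − 6φ₀ = 0`).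
-/

noncomputable section

open MeasureTheory Set Real intervalIntegral

namespace Literature.Analysis.FluidPDE

namespace Elgindi

/-- **`sinθcos²θ` is in the kernel of the adjoint angular operator**: for `u ∈ C²(ℝ)` with
`u(0) = u(π/2) = 0`,
`∫₀^{π/2}(−u''sinθcos²θ + u'sin²θcosθ + u(sinθ − 6sinθcos²θ))dθ = 0`. [cite: Elgindi2021, §7.1 proof of Proposition 7.1, Step 1 (p. 19 of arXiv:1904.04795)] -/
theorem integral_angularOp_mul_adjointMode {u : ℝ → ℝ} (hu : ContDiff ℝ 2 u) (h0 : u 0 = 0) (h1 : u (π / 2) = 0) :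
    ∫ θ in (0 : ℝ)..(π / 2), (-deriv (deriv u) θ * (Real.sin θ * Real.cos θ ^ 2) +
      deriv u θ * (Real.sin θ ^ 2 * Real.cos θ) + u θ * (Real.sin θ - 6 * (Real.sin θ * Real.cos θ ^ 2))) = 0 := by
  have hd1 : Differentiable ℝ u := hu.differentiable (by simp)
  have hu1 : ContDiff ℝ 1 (deriv u) := by
    have := hu.iterate_deriv' 1 1
    simpa using this
  have hd2 : Differentiable ℝ (deriv u) := hu1.differentiable (by simp)
  have hc2 : Continuous (deriv (deriv u)) := hu1.continuous_deriv le_rfl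
  -- the antiderivative `G = −u'φ₀ + uφ₀' + u sin²cos`, `φ₀ = sin cos²`, `φ₀' = cos³ − 2sin²cos`
  set G : ℝ → ℝ := fun θ => -deriv u θ * (Real.sin θ * Real.cos θ ^ 2) +
    u θ * (Real.cos θ ^ 3 - 2 * Real.sin θ ^ 2 * Real.cos θ) + u θ * (Real.sin θ ^ 2 * Real.cos θ) with hG
  have hder : ∀ θ ∈ Set.uIcc (0 : ℝ) (π / 2), HasDerivAt G (-deriv (deriv u) θ * (Real.sin θ * Real.cos θ ^ 2) +
      deriv u θ * (Real.sin θ ^ 2 * Real.cos θ) + u θ * (Real.sin θ - 6 * (Real.sin θ * Real.cos θ ^ 2))) θ := by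
    intro θ _
    have hs := Real.hasDerivAt_sin θ
    have hc := Real.hasDerivAt_cos θ
    have hu' : HasDerivAt u (deriv u θ) θ := (hd1 θ).hasDerivAt
    have hu'' : HasDerivAt (deriv u) (deriv (deriv u) θ) θ := (hd2 θ).hasDerivAt
    have hφ : HasDerivAt (fun θ => Real.sin θ * Real.cos θ ^ 2)
        (Real.cos θ * Real.cos θ ^ 2 + Real.sin θ * (2 * Real.cos θ * -Real.sin θ)) θ := by
      have := hs.mul (hc.pow 2)
      exact this.congr_deriv (by simp)
    have hφ' : HasDerivAt (fun θ => Real.cos θ ^ 3 - 2 * Real.sin θ ^ 2 * Real.cos θ)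
        (3 * Real.cos θ ^ 2 * -Real.sin θ - (2 * (2 * Real.sin θ * Real.cos θ) * Real.cos θ +
          2 * Real.sin θ ^ 2 * -Real.sin θ)) θ := by
      have h3 := hc.pow 3
      have h2 := ((hs.pow 2).const_mul 2).mul hc
      exact (h3.sub h2).congr_deriv (by simp)
    have hχ : HasDerivAt (fun θ => Real.sin θ ^ 2 * Real.cos θ)
        (2 * Real.sin θ * Real.cos θ * Real.cos θ + Real.sin θ ^ 2 * -Real.sin θ) θ := by
      have := (hs.pow 2).mul hc
      exact this.congr_deriv (by simp)
    have h := ((hu''.neg.mul hφ).add (hu'.mul hφ')).add (hu'.mul hχ)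
    refine h.congr_deriv ?_
    simp only [Pi.neg_apply]
    have := Real.sin_sq_add_cos_sq θ
    -- `sin − 6 sin cos² = sin³ − 5 sin cos²` modulo `sin² + cos² = 1`
    linear_combination (u θ * Real.sin θ) * this
  have hcont : Continuous fun θ => -deriv (deriv u) θ * (Real.sin θ * Real.cos θ ^ 2) +
      deriv u θ * (Real.sin θ ^ 2 * Real.cos θ) + u θ * (Real.sin θ - 6 * (Real.sin θ * Real.cos θ ^ 2)) := by
    have := hu.continuous
    have := hu1.continuous
    fun_prop
  rw [integral_eq_sub_of_hasDerivAt hder (hcont.intervalIntegrable _ _)]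
  simp [hG, h0, h1]

end Elgindi

end Literature.Analysis.FluidPDE
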